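import Literature.NumberTheory.Automorphic.UnitaryGroupKernelClassOneClassUnfolding
import Literature.NumberTheory.Automorphic.UnitaryGroupSingularBorelBasePoint
import Literature.NumberTheory.Automorphic.UnitaryGroupSingularCentralizerCovolume
import Literature.NumberTheory.Automorphic.UnitaryGroupSplitSemisimpleOrbitalIntegrable
import HarnessLib

/-!
# The SEMISIMPLE SUMMAND of the singular Borel class of `U(J₃)`, closed form:
# `∫_X Σ'_{s ∈ [γ₀]} f(x̃ s x̃⁻¹) dμ = c_μ · vol(G_{γ₀}(F)\G_{γ₀}(𝔸)) · Φ(γ₀, f)` — ALL THREE FACTORS FINITE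
(Rogawski, *Automorphic Representations of Unitary Groups in Three Variables* (1990), §7.2 Prop. 7.2.1 p. 91: the
first term `m(G_γ(F)\G_γ(𝔸)) Φ(γ, f)` of `J^T_𝔬(f)` at the class `𝔬` of `γ = d(a, b, a)`; Arthur, Duke Math. J. 45
(1978), §8; Gelbart (1975), (9.13), Remark 9.23)

Topic `NumberTheory/Automorphic`; namespace `Literature.NumberTheory.Automorphic.UnitaryGroup`.  THEOREMS ONLY (no
definition, no instance, no notation, no named fact, no `sorry`).  Cell `pub/hodgecm-mathlib`, ENGINE T1 (crux H413 =
`stmt-HodgeConjecture-24833`), T1-qs road LAW 5, row (L5-iii-b1) «SEMISIMPLE SUMMAND, CLOSED FORM» (F0P3a-p05 (g6) GO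
11:43:45Z).  ★ (L5-iii-b0) `kernelClass_singular_eq_tsum_conjOrbit_add_tsum` (`UnitaryGroupKernelClassSingularBorel`)
splits the class kernel `K_𝔬` of the singular Borel class `𝔬 ∋ γ₀ = ι(d(a,b,a))` POINTWISE into the sum over the ONE
semisimple `G(F)`-class `[γ₀] = conjOrbit G(F) γ₀` plus the non-semisimple part; this file integrates the semisimple part
over `X = G(𝔸) ⧸ G(F)`.  Unlike the elliptic classes (★ `UnitaryGroupKernelClassOrbitalUnfolding`, compact centraliser
quotients) the centraliser `G_{γ₀} ≅ U(1,1) × U(1)` is ISOTROPIC, so the compact-fibre input is replaced by the three ★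
letters of A-p14 (g20): the binder-free one-class brick (★ `lintegral_conjTsum_conjOrbit_eq_covol_mul_of_isClosed`), the
finite covolume (★ `quotientMeasure_centralizer_univ_lt_top_of_singular_quasiSplit`) and the integrable orbital integrand
(★ `lintegral_enorm_descConj_toAdelic_lt_top_of_mul_sub_eq_zero_quasiSplit`).  The result is `T`-INDEPENDENT, hence enters
the constant term `P_𝔬(0)` of the (σ-ii) socket of ★ `UnitaryGroupArthurTraceThreeSockets` verbatim.  HC_CM is proved only
modulo the printed citations until rung 0 closes; this file discharges none of them.

* (generic one-class unfolding WITHOUT compactness: ★ `UnitaryGroupKernelClassOneClassUnfolding` —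
  `lintegral_conjTsum_conjOrbit_eq_covol_mul_quasiSplit`, `integral_conjTsum_conjOrbit_eq_covol_mul_quasiSplit`.)
* (CM pair `L/L⁺`, `N = 3`, `γ₀ = ι(d(a,b,a))`, `a ≠ b`; row binders `hg₀ hγ₀ hab` FIRST, the letters of ★ (L5-iii-b0))
  `mul_sub_smul_eq_zero_of_eq_diag`, `isSemisimpleElt_of_eq_diag`, `not_isRegularElt_of_eq_diag`, `ne_smul_one_of_eq_diag`
  (the base point is split semisimple, not regular, not scalar); **`quotientMeasure_centralizer_univ_lt_top_of_eq_diag`**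
  (`vol < ∞` in those letters);
  **`lintegral_conjTsum_conjOrbit_singular_lt_top_cm`** — `∫⁻_X Σ'_{s ∈ [γ₀]} ‖f(x̃ s x̃⁻¹)‖ dμ < ∞` for `f ∈ C_c`;
  **`integral_conjTsum_conjOrbit_singular_eq_covol_mul_orbitalIntegral_cm`** — `x ↦ Σ'_{s ∈ [γ₀]} f(x̃ s x̃⁻¹)` is
  `μ`-integrable, the orbital integrand is `ν/ν_{γ₀}`-integrable, and
  `∫_X Σ'_{s ∈ [γ₀]} f dμ = c_μ · vol · O_{γ₀}^{ν/ν_{γ₀}}(f)` with `c_μ · vol ∈ (0, ∞)`.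

## References
* J. D. Rogawski, *Automorphic Representations of Unitary Groups in Three Variables*, Ann. of Math. Stud. 123 (1990),
  §7.2 Prop. 7.2.1 p. 91 [Rogawski1990].
* J. Arthur, *A trace formula for reductive groups I*, Duke Math. J. 45 (1978), §8 [Arthur1978TraceFormulaI].
* S. Gelbart, *Automorphic forms on adele groups*, Ann. of Math. Stud. 83 (1975), (9.13), Remark 9.23 [Gelbart1975].
-/

set_option autoImplicit false

noncomputable section

open MeasureTheory Measure Set Filter Topology
open Literature.MeasureTheory.Group
open scoped NNReal ENNReal Pointwise

namespace Literature.NumberTheory.Automorphic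

namespace UnitaryGroup

/-! ## The CM pair, `N = 3`: the semisimple summand of the singular Borel class is finite -/

section Singular

open _root_.NumberField _root_.Polynomial Literature.NumberTheory.Rogawski1990
open Literature.LinearAlgebra.Matrix (isSemisimple_toLin'_of_mul_sub_eq_zero)
open scoped _root_.MatrixGroups _root_.Matrix

variable (L : Type) [Field L] [NumberField L] [IsCMField L]

/-- `(d(a,b,a) − a)(d(a,b,a) − b) = 0` in `M₃(L)`. [cite: Rogawski1990, §3.8 Prop. 3.8.1 p. 27] -/
theorem mul_sub_smul_eq_zero_of_eq_diag {a b : Lˣ} {g₀ : (quasiSplit (↥(maximalRealSubfield L)) L (IsCMField.complexConj L) 3).Rational}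
    (hg₀ : ((g₀.val : GL (Fin 3) L) : Matrix (Fin 3) (Fin 3) L) = !![(a : L), 0, 0; 0, b, 0; 0, 0, a]) :
    (((g₀.val : GL (Fin 3) L) : Matrix (Fin 3) (Fin 3) L) - (a : L) • (1 : Matrix (Fin 3) (Fin 3) L)) *
      (((g₀.val : GL (Fin 3) L) : Matrix (Fin 3) (Fin 3) L) - (b : L) • (1 : Matrix (Fin 3) (Fin 3) L)) = 0 := by
  rw [hg₀]
  ext i j
  fin_cases i <;> fin_cases j <;> simp [Matrix.mul_apply, Fin.sum_univ_three, Matrix.one_apply]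

/-- `d(a,b,a)` is semisimple (★ `isSemisimple_toLin'_of_mul_sub_eq_zero`). [cite: Rogawski1990, §3.8 Prop. 3.8.1 p. 27] -/
theorem isSemisimpleElt_of_eq_diag {a b : Lˣ} {g₀ : (quasiSplit (↥(maximalRealSubfield L)) L (IsCMField.complexConj L) 3).Rational}
    (hg₀ : ((g₀.val : GL (Fin 3) L) : Matrix (Fin 3) (Fin 3) L) = !![(a : L), 0, 0; 0, b, 0; 0, 0, a])
    (hab : (a : L) ≠ (b : L)) :
    Rogawski1990.IsSemisimpleElt (cmConjRingHom L) ((StdForm.antidiagonal 3).over L) g₀ :=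
  isSemisimple_toLin'_of_mul_sub_eq_zero hab (mul_sub_smul_eq_zero_of_eq_diag L hg₀)

/-- `d(a,b,a)` is NOT regular: its characteristic polynomial `(X − a)²(X − b)` (★ `charpoly_of_eq_singularNormalForm`)
is not separable. [cite: Rogawski1990, §3.1 p. 19; §7.2 p. 91] -/
theorem not_isRegularElt_of_eq_diag {a b : Lˣ} {g₀ : (quasiSplit (↥(maximalRealSubfield L)) L (IsCMField.complexConj L) 3).Rational}
    (hg₀ : ((g₀.val : GL (Fin 3) L) : Matrix (Fin 3) (Fin 3) L) = !![(a : L), 0, 0; 0, b, 0; 0, 0, a]) :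
    ¬ IsRegularElt (g₀.val : GL (Fin 3) L) := by
  intro h
  rw [isRegularElt_iff, charpoly_of_eq_singularNormalForm (eq_singularNormalForm_zero_of_eq_diag hg₀)] at h
  have h2 := (Polynomial.Separable.of_pow (Polynomial.not_isUnit_X_sub_C (a : L)) two_ne_zero h.of_mul_left).2
  exact absurd h2 (by norm_num)

/-- `d(a,b,a)` is not a scalar (`a ≠ b`). [cite: Rogawski1990, §3.8 Prop. 3.8.1 p. 27] -/
theorem ne_smul_one_of_eq_diag {a b : Lˣ} {g₀ : (quasiSplit (↥(maximalRealSubfield L)) L (IsCMField.complexConj L) 3).Rational}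
    (hg₀ : ((g₀.val : GL (Fin 3) L) : Matrix (Fin 3) (Fin 3) L) = !![(a : L), 0, 0; 0, b, 0; 0, 0, a])
    (hab : (a : L) ≠ (b : L)) (ζ : L) :
    ((g₀.val : GL (Fin 3) L) : Matrix (Fin 3) (Fin 3) L) ≠ ζ • (1 : Matrix (Fin 3) (Fin 3) L) := by
  intro h
  rw [hg₀] at h
  have h00 := congrFun (congrFun h 0) 0
  have h11 := congrFun (congrFun h 1) 1
  simp at h00 h11
  exact hab (h00.trans h11.symm)

/-- **`vol(G_{γ₀} ⧸ G(F)_{γ₀}) < ∞` at the base point `γ₀ = ι(d(a,b,a))` of the singular Borel class** — ★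
`quotientMeasure_centralizer_univ_lt_top_of_singular_quasiSplit` re-keyed on the letters `(hg₀, hγ₀, hab)` of ★
(L5-iii-b0). [cite: Rogawski1990, §7.2 Prop. 7.2.1 p. 91] [cite: Borel1963, Thm. 5.8] -/
theorem quotientMeasure_centralizer_univ_lt_top_of_eq_diag {a b : Lˣ}
    {g₀ : (quasiSplit (↥(maximalRealSubfield L)) L (IsCMField.complexConj L) 3).Rational} {γ₀ : (quasiSplit (↥(maximalRealSubfield L)) L (IsCMField.complexConj L) 3).arithmeticSubgroup}
    (hg₀ : ((g₀.val : GL (Fin 3) L) : Matrix (Fin 3) (Fin 3) L) = !![(a : L), 0, 0; 0, b, 0; 0, 0, a])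
    (hγ₀ : (γ₀ : (quasiSplit (↥(maximalRealSubfield L)) L (IsCMField.complexConj L) 3).Adelic) = (quasiSplit (↥(maximalRealSubfield L)) L (IsCMField.complexConj L) 3).toAdelic g₀) (hab : (a : L) ≠ (b : L))
    [T2Space (quasiSplit (↥(maximalRealSubfield L)) L (IsCMField.complexConj L) 3).Adelic] [LocallyCompactSpace (quasiSplit (↥(maximalRealSubfield L)) L (IsCMField.complexConj L) 3).Adelic]
    [SecondCountableTopology (quasiSplit (↥(maximalRealSubfield L)) L (IsCMField.complexConj L) 3).Adelic]
    [MeasurableSpace (quasiSplit (↥(maximalRealSubfield L)) L (IsCMField.complexConj L) 3).Adelic] [BorelSpace (quasiSplit (↥(maximalRealSubfield L)) L (IsCMField.complexConj L) 3).Adelic]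
    [hCcl : IsClosed ((Subgroup.centralizer ({(γ₀ : (quasiSplit (↥(maximalRealSubfield L)) L (IsCMField.complexConj L) 3).Adelic)} : Set (quasiSplit (↥(maximalRealSubfield L)) L (IsCMField.complexConj L) 3).Adelic) :
      Subgroup (quasiSplit (↥(maximalRealSubfield L)) L (IsCMField.complexConj L) 3).Adelic) : Set (quasiSplit (↥(maximalRealSubfield L)) L (IsCMField.complexConj L) 3).Adelic)]
    (hΛ : IsClosed (((((quasiSplit (↥(maximalRealSubfield L)) L (IsCMField.complexConj L) 3).quotientSubgroup ⊓
        Subgroup.centralizer ({(γ₀ : (quasiSplit (↥(maximalRealSubfield L)) L (IsCMField.complexConj L) 3).Adelic)} : Set (quasiSplit (↥(maximalRealSubfield L)) L (IsCMField.complexConj L) 3).Adelic)).subgroupOf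
        (Subgroup.centralizer ({(γ₀ : (quasiSplit (↥(maximalRealSubfield L)) L (IsCMField.complexConj L) 3).Adelic)} : Set (quasiSplit (↥(maximalRealSubfield L)) L (IsCMField.complexConj L) 3).Adelic))) :
        Subgroup ↥(Subgroup.centralizer ({(γ₀ : (quasiSplit (↥(maximalRealSubfield L)) L (IsCMField.complexConj L) 3).Adelic)} : Set (quasiSplit (↥(maximalRealSubfield L)) L (IsCMField.complexConj L) 3).Adelic))) :
      Set ↥(Subgroup.centralizer ({(γ₀ : (quasiSplit (↥(maximalRealSubfield L)) L (IsCMField.complexConj L) 3).Adelic)} : Set (quasiSplit (↥(maximalRealSubfield L)) L (IsCMField.complexConj L) 3).Adelic))))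
    [MeasurableSpace (↥(Subgroup.centralizer ({(γ₀ : (quasiSplit (↥(maximalRealSubfield L)) L (IsCMField.complexConj L) 3).Adelic)} : Set (quasiSplit (↥(maximalRealSubfield L)) L (IsCMField.complexConj L) 3).Adelic)) ⧸
      ((quasiSplit (↥(maximalRealSubfield L)) L (IsCMField.complexConj L) 3).quotientSubgroup ⊓
        Subgroup.centralizer ({(γ₀ : (quasiSplit (↥(maximalRealSubfield L)) L (IsCMField.complexConj L) 3).Adelic)} : Set (quasiSplit (↥(maximalRealSubfield L)) L (IsCMField.complexConj L) 3).Adelic)).subgroupOf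
        (Subgroup.centralizer ({(γ₀ : (quasiSplit (↥(maximalRealSubfield L)) L (IsCMField.complexConj L) 3).Adelic)} : Set (quasiSplit (↥(maximalRealSubfield L)) L (IsCMField.complexConj L) 3).Adelic)))]
    [BorelSpace (↥(Subgroup.centralizer ({(γ₀ : (quasiSplit (↥(maximalRealSubfield L)) L (IsCMField.complexConj L) 3).Adelic)} : Set (quasiSplit (↥(maximalRealSubfield L)) L (IsCMField.complexConj L) 3).Adelic)) ⧸
      ((quasiSplit (↥(maximalRealSubfield L)) L (IsCMField.complexConj L) 3).quotientSubgroup ⊓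
        Subgroup.centralizer ({(γ₀ : (quasiSplit (↥(maximalRealSubfield L)) L (IsCMField.complexConj L) 3).Adelic)} : Set (quasiSplit (↥(maximalRealSubfield L)) L (IsCMField.complexConj L) 3).Adelic)).subgroupOf
        (Subgroup.centralizer ({(γ₀ : (quasiSplit (↥(maximalRealSubfield L)) L (IsCMField.complexConj L) 3).Adelic)} : Set (quasiSplit (↥(maximalRealSubfield L)) L (IsCMField.complexConj L) 3).Adelic)))]
    (ρ : Measure ↥(((quasiSplit (↥(maximalRealSubfield L)) L (IsCMField.complexConj L) 3).quotientSubgroup ⊓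
        Subgroup.centralizer ({(γ₀ : (quasiSplit (↥(maximalRealSubfield L)) L (IsCMField.complexConj L) 3).Adelic)} : Set (quasiSplit (↥(maximalRealSubfield L)) L (IsCMField.complexConj L) 3).Adelic)).subgroupOf
        (Subgroup.centralizer ({(γ₀ : (quasiSplit (↥(maximalRealSubfield L)) L (IsCMField.complexConj L) 3).Adelic)} : Set (quasiSplit (↥(maximalRealSubfield L)) L (IsCMField.complexConj L) 3).Adelic))))
    [ρ.IsMulLeftInvariant] [IsFiniteMeasureOnCompacts ρ] [ρ.IsOpenPosMeasure] [ρ.IsInvInvariant] [SFinite ρ]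
    (νC : Measure ↥(Subgroup.centralizer ({(γ₀ : (quasiSplit (↥(maximalRealSubfield L)) L (IsCMField.complexConj L) 3).Adelic)} : Set (quasiSplit (↥(maximalRealSubfield L)) L (IsCMField.complexConj L) 3).Adelic)))
    [IsHaarMeasure νC] [νC.IsMulRightInvariant] :
    quotientMeasure (((quasiSplit (↥(maximalRealSubfield L)) L (IsCMField.complexConj L) 3).quotientSubgroup ⊓
        Subgroup.centralizer ({(γ₀ : (quasiSplit (↥(maximalRealSubfield L)) L (IsCMField.complexConj L) 3).Adelic)} : Set (quasiSplit (↥(maximalRealSubfield L)) L (IsCMField.complexConj L) 3).Adelic)).subgroupOf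
        (Subgroup.centralizer ({(γ₀ : (quasiSplit (↥(maximalRealSubfield L)) L (IsCMField.complexConj L) 3).Adelic)} : Set (quasiSplit (↥(maximalRealSubfield L)) L (IsCMField.complexConj L) 3).Adelic))) ρ hΛ νC
      Set.univ < ∞ := by
  obtain ⟨γ₀v, hγ₀mem⟩ := γ₀
  change γ₀v = _ at hγ₀
  subst hγ₀
  exact quotientMeasure_centralizer_univ_lt_top_of_singular_quasiSplit L g₀ (isSemisimpleElt_of_eq_diag L hg₀ hab)
    (not_isRegularElt_of_eq_diag L hg₀) (ne_smul_one_of_eq_diag L hg₀ hab) hΛ ρ νC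

/-- **`∫⁻_X Σ'_{s ∈ [γ₀]} ‖f(x̃ s x̃⁻¹)‖ dμ < ∞` for `f ∈ C_c(U(J₃)(𝔸))` at the singular base point `γ₀ = ι(d(a,b,a))`**
(§1 with `c_μ < ∞`, `vol < ∞` — `quotientMeasure_centralizer_univ_lt_top_of_eq_diag` — and `O_{γ₀}(‖f‖) < ∞` — ★
`lintegral_enorm_descConj_toAdelic_lt_top_of_mul_sub_eq_zero_quasiSplit`): the semisimple part of the singular Borel class
kernel is absolutely integrable over `X` although `G_{γ₀} ⧸ G(F)_{γ₀}` is not compact.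
[cite: Rogawski1990, §7.2 Prop. 7.2.1 p. 91] [cite: Arthur1978TraceFormulaI, §8] -/
theorem lintegral_conjTsum_conjOrbit_singular_lt_top_cm {a b : Lˣ}
    {g₀ : (quasiSplit (↥(maximalRealSubfield L)) L (IsCMField.complexConj L) 3).Rational} {γ₀ : (quasiSplit (↥(maximalRealSubfield L)) L (IsCMField.complexConj L) 3).arithmeticSubgroup}
    (hg₀ : ((g₀.val : GL (Fin 3) L) : Matrix (Fin 3) (Fin 3) L) = !![(a : L), 0, 0; 0, b, 0; 0, 0, a])
    (hγ₀ : (γ₀ : (quasiSplit (↥(maximalRealSubfield L)) L (IsCMField.complexConj L) 3).Adelic) = (quasiSplit (↥(maximalRealSubfield L)) L (IsCMField.complexConj L) 3).toAdelic g₀) (hab : (a : L) ≠ (b : L))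
    [T2Space (quasiSplit (↥(maximalRealSubfield L)) L (IsCMField.complexConj L) 3).Adelic] [LocallyCompactSpace (quasiSplit (↥(maximalRealSubfield L)) L (IsCMField.complexConj L) 3).Adelic]
    [SecondCountableTopology (quasiSplit (↥(maximalRealSubfield L)) L (IsCMField.complexConj L) 3).Adelic]
    [MeasurableSpace (quasiSplit (↥(maximalRealSubfield L)) L (IsCMField.complexConj L) 3).Adelic] [BorelSpace (quasiSplit (↥(maximalRealSubfield L)) L (IsCMField.complexConj L) 3).Adelic]
    [hL : IsClosed (((quasiSplit (↥(maximalRealSubfield L)) L (IsCMField.complexConj L) 3).quotientSubgroup : Set (quasiSplit (↥(maximalRealSubfield L)) L (IsCMField.complexConj L) 3).Adelic))]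
    [hCcl : IsClosed ((Subgroup.centralizer ({(γ₀ : (quasiSplit (↥(maximalRealSubfield L)) L (IsCMField.complexConj L) 3).Adelic)} : Set (quasiSplit (↥(maximalRealSubfield L)) L (IsCMField.complexConj L) 3).Adelic) :
      Subgroup (quasiSplit (↥(maximalRealSubfield L)) L (IsCMField.complexConj L) 3).Adelic) : Set (quasiSplit (↥(maximalRealSubfield L)) L (IsCMField.complexConj L) 3).Adelic)]
    [MeasurableSpace ((quasiSplit (↥(maximalRealSubfield L)) L (IsCMField.complexConj L) 3).Adelic ⧸ (quasiSplit (↥(maximalRealSubfield L)) L (IsCMField.complexConj L) 3).quotientSubgroup)]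
    [BorelSpace ((quasiSplit (↥(maximalRealSubfield L)) L (IsCMField.complexConj L) 3).Adelic ⧸ (quasiSplit (↥(maximalRealSubfield L)) L (IsCMField.complexConj L) 3).quotientSubgroup)]
    [MeasurableSpace ((quasiSplit (↥(maximalRealSubfield L)) L (IsCMField.complexConj L) 3).Adelic ⧸
      Subgroup.centralizer ({(γ₀ : (quasiSplit (↥(maximalRealSubfield L)) L (IsCMField.complexConj L) 3).Adelic)} : Set (quasiSplit (↥(maximalRealSubfield L)) L (IsCMField.complexConj L) 3).Adelic))]
    [BorelSpace ((quasiSplit (↥(maximalRealSubfield L)) L (IsCMField.complexConj L) 3).Adelic ⧸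
      Subgroup.centralizer ({(γ₀ : (quasiSplit (↥(maximalRealSubfield L)) L (IsCMField.complexConj L) 3).Adelic)} : Set (quasiSplit (↥(maximalRealSubfield L)) L (IsCMField.complexConj L) 3).Adelic))]
    [MeasurableSpace (↥(Subgroup.centralizer ({(γ₀ : (quasiSplit (↥(maximalRealSubfield L)) L (IsCMField.complexConj L) 3).Adelic)} : Set (quasiSplit (↥(maximalRealSubfield L)) L (IsCMField.complexConj L) 3).Adelic)) ⧸
      ((quasiSplit (↥(maximalRealSubfield L)) L (IsCMField.complexConj L) 3).quotientSubgroup ⊓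
        Subgroup.centralizer ({(γ₀ : (quasiSplit (↥(maximalRealSubfield L)) L (IsCMField.complexConj L) 3).Adelic)} : Set (quasiSplit (↥(maximalRealSubfield L)) L (IsCMField.complexConj L) 3).Adelic)).subgroupOf
        (Subgroup.centralizer ({(γ₀ : (quasiSplit (↥(maximalRealSubfield L)) L (IsCMField.complexConj L) 3).Adelic)} : Set (quasiSplit (↥(maximalRealSubfield L)) L (IsCMField.complexConj L) 3).Adelic)))]
    [BorelSpace (↥(Subgroup.centralizer ({(γ₀ : (quasiSplit (↥(maximalRealSubfield L)) L (IsCMField.complexConj L) 3).Adelic)} : Set (quasiSplit (↥(maximalRealSubfield L)) L (IsCMField.complexConj L) 3).Adelic)) ⧸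
      ((quasiSplit (↥(maximalRealSubfield L)) L (IsCMField.complexConj L) 3).quotientSubgroup ⊓
        Subgroup.centralizer ({(γ₀ : (quasiSplit (↥(maximalRealSubfield L)) L (IsCMField.complexConj L) 3).Adelic)} : Set (quasiSplit (↥(maximalRealSubfield L)) L (IsCMField.complexConj L) 3).Adelic)).subgroupOf
        (Subgroup.centralizer ({(γ₀ : (quasiSplit (↥(maximalRealSubfield L)) L (IsCMField.complexConj L) 3).Adelic)} : Set (quasiSplit (↥(maximalRealSubfield L)) L (IsCMField.complexConj L) 3).Adelic)))]
    [(count : Measure ↥(((quasiSplit (↥(maximalRealSubfield L)) L (IsCMField.complexConj L) 3).quotientSubgroup ⊓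
      Subgroup.centralizer ({(γ₀ : (quasiSplit (↥(maximalRealSubfield L)) L (IsCMField.complexConj L) 3).Adelic)} : Set (quasiSplit (↥(maximalRealSubfield L)) L (IsCMField.complexConj L) 3).Adelic)).subgroupOf
        (Subgroup.centralizer ({(γ₀ : (quasiSplit (↥(maximalRealSubfield L)) L (IsCMField.complexConj L) 3).Adelic)} : Set (quasiSplit (↥(maximalRealSubfield L)) L (IsCMField.complexConj L) 3).Adelic)))).IsHaarMeasure]
    [(count : Measure (quasiSplit (↥(maximalRealSubfield L)) L (IsCMField.complexConj L) 3).quotientSubgroup).IsHaarMeasure]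
    (μ : Measure ((quasiSplit (↥(maximalRealSubfield L)) L (IsCMField.complexConj L) 3).Adelic ⧸ (quasiSplit (↥(maximalRealSubfield L)) L (IsCMField.complexConj L) 3).quotientSubgroup))
    [SMulInvariantMeasure (quasiSplit (↥(maximalRealSubfield L)) L (IsCMField.complexConj L) 3).Adelic ((quasiSplit (↥(maximalRealSubfield L)) L (IsCMField.complexConj L) 3).Adelic ⧸ (quasiSplit (↥(maximalRealSubfield L)) L (IsCMField.complexConj L) 3).quotientSubgroup) μ]
    [IsFiniteMeasureOnCompacts μ] (hμ : μ ≠ 0)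
    (ν : Measure (quasiSplit (↥(maximalRealSubfield L)) L (IsCMField.complexConj L) 3).Adelic) [IsHaarMeasure ν] [ν.IsMulRightInvariant]
    (ν₀ : Measure ↥(Subgroup.centralizer ({(γ₀ : (quasiSplit (↥(maximalRealSubfield L)) L (IsCMField.complexConj L) 3).Adelic)} : Set (quasiSplit (↥(maximalRealSubfield L)) L (IsCMField.complexConj L) 3).Adelic)))
    [IsHaarMeasure ν₀] [ν₀.IsMulRightInvariant] [ν₀.IsInvInvariant]
    {E' : Type*} [NormedAddCommGroup E'] {f : (quasiSplit (↥(maximalRealSubfield L)) L (IsCMField.complexConj L) 3).Adelic → E'} (hfc : Continuous f) (hf : HasCompactSupport f) :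
    ∫⁻ x, conjTsum (quasiSplit (↥(maximalRealSubfield L)) L (IsCMField.complexConj L) 3).quotientSubgroup
        (conjOrbit (quasiSplit (↥(maximalRealSubfield L)) L (IsCMField.complexConj L) 3).arithmeticSubgroup (γ₀ : (quasiSplit (↥(maximalRealSubfield L)) L (IsCMField.complexConj L) 3).Adelic))
        (conj_mem_conjOrbit_of_exists (quasiSplit (↥(maximalRealSubfield L)) L (IsCMField.complexConj L) 3).arithmeticSubgroup (quasiSplit (↥(maximalRealSubfield L)) L (IsCMField.complexConj L) 3).quotientSubgroup
          (AdelicGroupData.exists_inv_mul_mem_centralizer_quotientSubgroup (quasiSplit (↥(maximalRealSubfield L)) L (IsCMField.complexConj L) 3)) γ₀.2) (fun g => ‖f g‖ₑ) x ∂μ < ∞ := by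
  haveI : Countable ↥(((quasiSplit (↥(maximalRealSubfield L)) L (IsCMField.complexConj L) 3).quotientSubgroup ⊓
      Subgroup.centralizer ({(γ₀ : (quasiSplit (↥(maximalRealSubfield L)) L (IsCMField.complexConj L) 3).Adelic)} : Set (quasiSplit (↥(maximalRealSubfield L)) L (IsCMField.complexConj L) 3).Adelic)).subgroupOf
      (Subgroup.centralizer ({(γ₀ : (quasiSplit (↥(maximalRealSubfield L)) L (IsCMField.complexConj L) 3).Adelic)} : Set (quasiSplit (↥(maximalRealSubfield L)) L (IsCMField.complexConj L) 3).Adelic))) :=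
    countable_quotientSubgroup_inf_subgroupOf_quasiSplit _
  rw [lintegral_conjTsum_conjOrbit_eq_covol_mul_quasiSplit γ₀ μ hμ ν ν₀ hfc.enorm.measurable]
  refine ENNReal.mul_lt_top (ENNReal.mul_lt_top ENNReal.coe_lt_top ?_) ?_
  · exact quotientMeasure_centralizer_univ_lt_top_of_eq_diag L hg₀ hγ₀ hab _ count ν₀
  · obtain ⟨γ₀v, hγ₀mem⟩ := γ₀
    change γ₀v = _ at hγ₀
    subst hγ₀
    exact lintegral_enorm_descConj_toAdelic_lt_top_of_mul_sub_eq_zero_quasiSplit L g₀ hab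
      (mul_sub_smul_eq_zero_of_eq_diag L hg₀) hfc hf _

/-- **THE SEMISIMPLE SUMMAND OF THE SINGULAR BOREL CLASS, CLOSED FORM** [Prop. 7.2.1, first term
`m(G_γ(F)∖G_γ(𝔸))·Φ(γ, f)`]: for `f ∈ C_c(U(J₃)(𝔸_{L⁺}); ℂ)` and the base point `γ₀ = ι(d(a,b,a))`, `a ≠ b`, of the singular
Borel class: `[x] ↦ Σ'_{s ∈ [γ₀]} f(x̃ s x̃⁻¹)` is `μ`-integrable, `y ↦ f(y γ₀ y⁻¹)` is `ν/ν₀`-integrable, and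

  `∫_X Σ'_{s ∈ [γ₀]} f(x̃ s x̃⁻¹) dμ(x) = (c_μ · vol(G_{γ₀} ⧸ G(F)_{γ₀})).toReal · ∫_{G(𝔸) ⧸ G_{γ₀}} f(y γ₀ y⁻¹) d(ν/ν₀)(y)`

with `c_μ · vol ∈ (0, ∞)` (`quotientMeasure_centralizer_univ_lt_top_of_eq_diag`) — the `T`-independent first summand of
`J^T_𝔬(f)` at `𝔬 ∋ γ₀`, to be combined with ★ (R2) `kernelClass_singular_eq_tsum_conjOrbit_add_tsum` and the (held)
truncated non-semisimple half. [cite: Rogawski1990, §7.2 Prop. 7.2.1 p. 91] [cite: Arthur1978TraceFormulaI, §8]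
[cite: Gelbart1975, (9.13) and Remark 9.23] -/
theorem integral_conjTsum_conjOrbit_singular_eq_covol_mul_cm {a b : Lˣ}
    {g₀ : (quasiSplit (↥(maximalRealSubfield L)) L (IsCMField.complexConj L) 3).Rational} {γ₀ : (quasiSplit (↥(maximalRealSubfield L)) L (IsCMField.complexConj L) 3).arithmeticSubgroup}
    (hg₀ : ((g₀.val : GL (Fin 3) L) : Matrix (Fin 3) (Fin 3) L) = !![(a : L), 0, 0; 0, b, 0; 0, 0, a])
    (hγ₀ : (γ₀ : (quasiSplit (↥(maximalRealSubfield L)) L (IsCMField.complexConj L) 3).Adelic) = (quasiSplit (↥(maximalRealSubfield L)) L (IsCMField.complexConj L) 3).toAdelic g₀) (hab : (a : L) ≠ (b : L))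
    [T2Space (quasiSplit (↥(maximalRealSubfield L)) L (IsCMField.complexConj L) 3).Adelic] [LocallyCompactSpace (quasiSplit (↥(maximalRealSubfield L)) L (IsCMField.complexConj L) 3).Adelic]
    [SecondCountableTopology (quasiSplit (↥(maximalRealSubfield L)) L (IsCMField.complexConj L) 3).Adelic]
    [MeasurableSpace (quasiSplit (↥(maximalRealSubfield L)) L (IsCMField.complexConj L) 3).Adelic] [BorelSpace (quasiSplit (↥(maximalRealSubfield L)) L (IsCMField.complexConj L) 3).Adelic]
    [hL : IsClosed (((quasiSplit (↥(maximalRealSubfield L)) L (IsCMField.complexConj L) 3).quotientSubgroup : Set (quasiSplit (↥(maximalRealSubfield L)) L (IsCMField.complexConj L) 3).Adelic))]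
    [hCcl : IsClosed ((Subgroup.centralizer ({(γ₀ : (quasiSplit (↥(maximalRealSubfield L)) L (IsCMField.complexConj L) 3).Adelic)} : Set (quasiSplit (↥(maximalRealSubfield L)) L (IsCMField.complexConj L) 3).Adelic) :
      Subgroup (quasiSplit (↥(maximalRealSubfield L)) L (IsCMField.complexConj L) 3).Adelic) : Set (quasiSplit (↥(maximalRealSubfield L)) L (IsCMField.complexConj L) 3).Adelic)]
    [MeasurableSpace ((quasiSplit (↥(maximalRealSubfield L)) L (IsCMField.complexConj L) 3).Adelic ⧸ (quasiSplit (↥(maximalRealSubfield L)) L (IsCMField.complexConj L) 3).quotientSubgroup)]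
    [BorelSpace ((quasiSplit (↥(maximalRealSubfield L)) L (IsCMField.complexConj L) 3).Adelic ⧸ (quasiSplit (↥(maximalRealSubfield L)) L (IsCMField.complexConj L) 3).quotientSubgroup)]
    [MeasurableSpace ((quasiSplit (↥(maximalRealSubfield L)) L (IsCMField.complexConj L) 3).Adelic ⧸
      Subgroup.centralizer ({(γ₀ : (quasiSplit (↥(maximalRealSubfield L)) L (IsCMField.complexConj L) 3).Adelic)} : Set (quasiSplit (↥(maximalRealSubfield L)) L (IsCMField.complexConj L) 3).Adelic))]
    [BorelSpace ((quasiSplit (↥(maximalRealSubfield L)) L (IsCMField.complexConj L) 3).Adelic ⧸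
      Subgroup.centralizer ({(γ₀ : (quasiSplit (↥(maximalRealSubfield L)) L (IsCMField.complexConj L) 3).Adelic)} : Set (quasiSplit (↥(maximalRealSubfield L)) L (IsCMField.complexConj L) 3).Adelic))]
    [MeasurableSpace (↥(Subgroup.centralizer ({(γ₀ : (quasiSplit (↥(maximalRealSubfield L)) L (IsCMField.complexConj L) 3).Adelic)} : Set (quasiSplit (↥(maximalRealSubfield L)) L (IsCMField.complexConj L) 3).Adelic)) ⧸
      ((quasiSplit (↥(maximalRealSubfield L)) L (IsCMField.complexConj L) 3).quotientSubgroup ⊓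
        Subgroup.centralizer ({(γ₀ : (quasiSplit (↥(maximalRealSubfield L)) L (IsCMField.complexConj L) 3).Adelic)} : Set (quasiSplit (↥(maximalRealSubfield L)) L (IsCMField.complexConj L) 3).Adelic)).subgroupOf
        (Subgroup.centralizer ({(γ₀ : (quasiSplit (↥(maximalRealSubfield L)) L (IsCMField.complexConj L) 3).Adelic)} : Set (quasiSplit (↥(maximalRealSubfield L)) L (IsCMField.complexConj L) 3).Adelic)))]
    [BorelSpace (↥(Subgroup.centralizer ({(γ₀ : (quasiSplit (↥(maximalRealSubfield L)) L (IsCMField.complexConj L) 3).Adelic)} : Set (quasiSplit (↥(maximalRealSubfield L)) L (IsCMField.complexConj L) 3).Adelic)) ⧸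
      ((quasiSplit (↥(maximalRealSubfield L)) L (IsCMField.complexConj L) 3).quotientSubgroup ⊓
        Subgroup.centralizer ({(γ₀ : (quasiSplit (↥(maximalRealSubfield L)) L (IsCMField.complexConj L) 3).Adelic)} : Set (quasiSplit (↥(maximalRealSubfield L)) L (IsCMField.complexConj L) 3).Adelic)).subgroupOf
        (Subgroup.centralizer ({(γ₀ : (quasiSplit (↥(maximalRealSubfield L)) L (IsCMField.complexConj L) 3).Adelic)} : Set (quasiSplit (↥(maximalRealSubfield L)) L (IsCMField.complexConj L) 3).Adelic)))]
    [(count : Measure ↥(((quasiSplit (↥(maximalRealSubfield L)) L (IsCMField.complexConj L) 3).quotientSubgroup ⊓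
      Subgroup.centralizer ({(γ₀ : (quasiSplit (↥(maximalRealSubfield L)) L (IsCMField.complexConj L) 3).Adelic)} : Set (quasiSplit (↥(maximalRealSubfield L)) L (IsCMField.complexConj L) 3).Adelic)).subgroupOf
        (Subgroup.centralizer ({(γ₀ : (quasiSplit (↥(maximalRealSubfield L)) L (IsCMField.complexConj L) 3).Adelic)} : Set (quasiSplit (↥(maximalRealSubfield L)) L (IsCMField.complexConj L) 3).Adelic)))).IsHaarMeasure]
    [(count : Measure (quasiSplit (↥(maximalRealSubfield L)) L (IsCMField.complexConj L) 3).quotientSubgroup).IsHaarMeasure]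
    (μ : Measure ((quasiSplit (↥(maximalRealSubfield L)) L (IsCMField.complexConj L) 3).Adelic ⧸ (quasiSplit (↥(maximalRealSubfield L)) L (IsCMField.complexConj L) 3).quotientSubgroup))
    [SMulInvariantMeasure (quasiSplit (↥(maximalRealSubfield L)) L (IsCMField.complexConj L) 3).Adelic ((quasiSplit (↥(maximalRealSubfield L)) L (IsCMField.complexConj L) 3).Adelic ⧸ (quasiSplit (↥(maximalRealSubfield L)) L (IsCMField.complexConj L) 3).quotientSubgroup) μ]
    [IsFiniteMeasureOnCompacts μ] (hμ : μ ≠ 0)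
    (ν : Measure (quasiSplit (↥(maximalRealSubfield L)) L (IsCMField.complexConj L) 3).Adelic) [IsHaarMeasure ν] [ν.IsMulRightInvariant]
    (ν₀ : Measure ↥(Subgroup.centralizer ({(γ₀ : (quasiSplit (↥(maximalRealSubfield L)) L (IsCMField.complexConj L) 3).Adelic)} : Set (quasiSplit (↥(maximalRealSubfield L)) L (IsCMField.complexConj L) 3).Adelic)))
    [IsHaarMeasure ν₀] [ν₀.IsMulRightInvariant] [ν₀.IsInvInvariant]
    {f : (quasiSplit (↥(maximalRealSubfield L)) L (IsCMField.complexConj L) 3).Adelic → ℂ} (hfc : Continuous f) (hf : HasCompactSupport f) :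
    Integrable (conjTsum (quasiSplit (↥(maximalRealSubfield L)) L (IsCMField.complexConj L) 3).quotientSubgroup
        (conjOrbit (quasiSplit (↥(maximalRealSubfield L)) L (IsCMField.complexConj L) 3).arithmeticSubgroup (γ₀ : (quasiSplit (↥(maximalRealSubfield L)) L (IsCMField.complexConj L) 3).Adelic))
        (conj_mem_conjOrbit_of_exists (quasiSplit (↥(maximalRealSubfield L)) L (IsCMField.complexConj L) 3).arithmeticSubgroup (quasiSplit (↥(maximalRealSubfield L)) L (IsCMField.complexConj L) 3).quotientSubgroup
          (AdelicGroupData.exists_inv_mul_mem_centralizer_quotientSubgroup (quasiSplit (↥(maximalRealSubfield L)) L (IsCMField.complexConj L) 3)) γ₀.2) f) μ ∧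
    Integrable (descConj (γ₀ : (quasiSplit (↥(maximalRealSubfield L)) L (IsCMField.complexConj L) 3).Adelic)
            (Subgroup.centralizer ({(γ₀ : (quasiSplit (↥(maximalRealSubfield L)) L (IsCMField.complexConj L) 3).Adelic)} : Set (quasiSplit (↥(maximalRealSubfield L)) L (IsCMField.complexConj L) 3).Adelic))
            (fun _ hg => Subgroup.mem_centralizer_singleton_iff.1 hg) f) (quotientMeasure (Subgroup.centralizer ({(γ₀ : (quasiSplit (↥(maximalRealSubfield L)) L (IsCMField.complexConj L) 3).Adelic)} : Set (quasiSplit (↥(maximalRealSubfield L)) L (IsCMField.complexConj L) 3).Adelic))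
            ν₀ hCcl ν) ∧
    ∫ x, conjTsum (quasiSplit (↥(maximalRealSubfield L)) L (IsCMField.complexConj L) 3).quotientSubgroup
        (conjOrbit (quasiSplit (↥(maximalRealSubfield L)) L (IsCMField.complexConj L) 3).arithmeticSubgroup (γ₀ : (quasiSplit (↥(maximalRealSubfield L)) L (IsCMField.complexConj L) 3).Adelic))
        (conj_mem_conjOrbit_of_exists (quasiSplit (↥(maximalRealSubfield L)) L (IsCMField.complexConj L) 3).arithmeticSubgroup (quasiSplit (↥(maximalRealSubfield L)) L (IsCMField.complexConj L) 3).quotientSubgroup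
          (AdelicGroupData.exists_inv_mul_mem_centralizer_quotientSubgroup (quasiSplit (↥(maximalRealSubfield L)) L (IsCMField.complexConj L) 3)) γ₀.2) f x ∂μ =
      (((unfoldingConstant (quasiSplit (↥(maximalRealSubfield L)) L (IsCMField.complexConj L) 3).quotientSubgroup (count : Measure (quasiSplit (↥(maximalRealSubfield L)) L (IsCMField.complexConj L) 3).quotientSubgroup) μ ν : ℝ≥0∞) *
        quotientMeasure (((quasiSplit (↥(maximalRealSubfield L)) L (IsCMField.complexConj L) 3).quotientSubgroup ⊓
            Subgroup.centralizer ({(γ₀ : (quasiSplit (↥(maximalRealSubfield L)) L (IsCMField.complexConj L) 3).Adelic)} : Set (quasiSplit (↥(maximalRealSubfield L)) L (IsCMField.complexConj L) 3).Adelic)).subgroupOf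
            (Subgroup.centralizer ({(γ₀ : (quasiSplit (↥(maximalRealSubfield L)) L (IsCMField.complexConj L) 3).Adelic)} : Set (quasiSplit (↥(maximalRealSubfield L)) L (IsCMField.complexConj L) 3).Adelic)))
          count (isClosed_subgroupOf _ _ (hL.inter hCcl)) ν₀ Set.univ).toReal : ℂ) *
        ∫ y, descConj (γ₀ : (quasiSplit (↥(maximalRealSubfield L)) L (IsCMField.complexConj L) 3).Adelic)
            (Subgroup.centralizer ({(γ₀ : (quasiSplit (↥(maximalRealSubfield L)) L (IsCMField.complexConj L) 3).Adelic)} : Set (quasiSplit (↥(maximalRealSubfield L)) L (IsCMField.complexConj L) 3).Adelic))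
            (fun _ hg => Subgroup.mem_centralizer_singleton_iff.1 hg) f y ∂quotientMeasure (Subgroup.centralizer ({(γ₀ : (quasiSplit (↥(maximalRealSubfield L)) L (IsCMField.complexConj L) 3).Adelic)} : Set (quasiSplit (↥(maximalRealSubfield L)) L (IsCMField.complexConj L) 3).Adelic))
            ν₀ hCcl ν :=
  integral_conjTsum_conjOrbit_eq_covol_mul_quasiSplit γ₀ μ hμ ν ν₀ hfc.measurable
    (lintegral_conjTsum_conjOrbit_singular_lt_top_cm L hg₀ hγ₀ hab μ hμ ν ν₀ hfc hf)

end Singular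

end UnitaryGroup

end Literature.NumberTheory.Automorphic
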